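import Summits.QuantumFields.YangMills.Theorems.RenyiTelescopeHistoryTailOfRenyiTelescopeR
import Summits.QuantumFields.YangMills.Theorems.SmallFieldWideningLargeFieldMassRefinementTailOfRenyiTelescope

/-!
# Crux r3 `LargeFieldMassRefinementTail` (stmt-QuantumFields-22884) ⇐ the REPAIRED Rényi telescope `CutoffRenyiLR ∧ FineRegimeUnitTailL`
# (width seat `ym-line-sfw-p2-w3` g23 of cell `ym-idea-1`; conditional certificate, re-basing `…OfRenyiTelescope` (w2 g18, p626492) on the repair)

On 2026-08-28 the crux `CutoffRenyiL` (stmt-QuantumFields-27137) of route `RenyiTelescope`, on which the certificate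
`LargeFieldMassRefinementTailOfRenyiTelescope.largeFieldMassRefinementTail_of_renyiTelescope` (p626492) rests, was set ASIDE (predicted false as
typed by the one-loop `O(g²a)` coupling renormalisation in `d = 3`, Moore 1998) and replaced by the REPAIRED crux `CutoffRenyiLR`
(stmt-QuantumFields-27544).  This file re-bases the r3 certificate on the repair: the unit-event tail schema of route `RenyiTelescope` is now
produced by the re-glue's instantiation `RenyiTelescope.stub_glueRestR` (p628443) from `stub_telescopedCruxR` (p627810) and `stub_arithClosureR`
(p627824), and w2 g18's crux-independent `unitTopSummable_of_unitEventSchema` turns it into skeleton v7's registered stub `stub_unitTopSummable`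
of crux r3, whence r3 BY NAME through the lead's `largeFieldMassRefinementTail_of_unitTopSummable`.
* `unitTopSummable_of_renyiTelescopeR : CutoffRenyiLR → FineRegimeUnitTailL → ‹stub_unitTopSummable›`;
* ★ `largeFieldMassRefinementTail_of_renyiTelescopeR : CutoffRenyiLR → FineRegimeUnitTailL → SmallFieldWidening.LargeFieldMassRefinementTail`;
* `historyTailL_and_largeFieldMassRefinementTail_of_renyiTelescopeR` — the STAFFING FACT after the repair: closing 27544 + 27138 closes
  `HistoryTailL` (19936, via the re-glue `historyTailOfRenyiTelescopeR`, item 27545) AND r3 (22884).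

WHAT THIS IS NOT: `CutoffRenyiLR` and `FineRegimeUnitTailL` are OPEN (XL); conditional certificates only; crux r3, `HistoryTailL`, the rung R3
(`YM3TorusSU2`, RECORD label) and the Yang–Mills mass gap are NOT proved by any of this.

References: T. Bałaban, CMP 102 (1985) 255–275 [Balaban1985UV3] ((7) p.257, (70)–(71) p.273); C. King, CMP 103 (1986) 323–349 [King1986] (Thm 3.4);
G. D. Moore, Nucl. Phys. B523 (1998) 569 [arXiv:hep-lat/9709053].
-/

noncomputable section

open Literature.MathematicalPhysics.QuantumFieldTheory.Balaban1983to89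
open Literature.MathematicalPhysics.QuantumFieldTheory.Balaban1983to89.T3ContinuumYM3Torus
open Summit.QuantumFields.YangMills.Theorems.LargeFieldMassRefinementTailOfSummableUnitTop (largeFieldMassRefinementTail_of_unitTopSummable)
open Summit.QuantumFields.YangMills.Theorems.LargeFieldMassRefinementTailOfRenyiTelescope (unitTopSummable_of_unitEventSchema)

namespace Summit.QuantumFields.YangMills.Theorems.LargeFieldMassRefinementTailOfRenyiTelescopeR

/-- **Skeleton v7's registered stub `stub_unitTopSummable` of crux r3 ⇐ the REPAIRED cruxes of route `RenyiTelescope`** (`CutoffRenyiLR`,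
`FineRegimeUnitTailL`), through the re-glue's instantiation `stub_glueRestR` and w2 g18's `unitTopSummable_of_unitEventSchema`.  Conditional.
[cite: Balaban1985UV3, (7) p.257 and (70)-(71) p.273; King1986, Thm 3.4 p.334] -/
theorem unitTopSummable_of_renyiTelescopeR
    (hC : Summit.QuantumFields.YangMills.Theses.RenyiTelescope.CutoffRenyiLR)
    (hF : Summit.QuantumFields.YangMills.Theses.RenyiTelescope.FineRegimeUnitTailL) :
    ∀ L : ℕ, ∃ (b₀ p₀ γ₁ : ℝ), 0 < b₀ ∧ 2 < p₀ ∧ 0 < γ₁ ∧ γ₁ ≤ 1 ∧ ∀ (F : T3Family) (γ : ℝ), F.L = L → 0 < γ → γ ≤ γ₁ →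
      ∃ q : ℕ → ℝ, (∀ d, 0 ≤ q d) ∧ Summable (fun d : ℕ => ((F.L : ℝ) ^ d) ^ 3 * q d) ∧
        ∀ (d K : ℕ), 2 ≤ K → ∀ p : Plaq ((F.refine d).P K) K,
          (T3UnitScaleTilt.gibbsK (F.refine d) T3UnitLawDensityEML.ℰp (γ * ((F.L : ℝ)⁻¹) ^ d) K).real
              {V | (∀ k, k < K → PlaqSmall (T3UnitScaleTilt.θBal F.L (γ * ((F.L : ℝ)⁻¹) ^ d) b₀ p₀ (K - k))
                  (Averaging.iter (fun i => BlockAveraging.blockAvg (P := (F.refine d).P K) (j := i) T3UnitLawDensityEML.ℰp) k V)) ∧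
                T3UnitScaleTilt.θBal F.L (γ * ((F.L : ℝ)⁻¹) ^ d) b₀ p₀ 0 ≤ GaugeGroup.dist1 (GaugeField.plaqHol
                  (Averaging.iter (fun i => BlockAveraging.blockAvg (P := (F.refine d).P K) (j := i) T3UnitLawDensityEML.ℰp) K V) p)} ≤
            q d :=
  unitTopSummable_of_unitEventSchema
    (RenyiTelescope.stub_glueRestR (RenyiTelescope.stub_telescopedCruxR hC RenyiTelescope.stub_conditionalTelescope) hF
      RenyiTelescope.stub_abstractBootstrap RenyiTelescope.stub_interiorComplement RenyiTelescope.stub_arithClosureR)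

/-- ★ **CRUX r3 `LargeFieldMassRefinementTail` (stmt-QuantumFields-22884) ⇐ `CutoffRenyiLR ∧ FineRegimeUnitTailL`**, BY NAME, through the lead's
landed glue `largeFieldMassRefinementTail_of_unitTopSummable` (skeleton v7).  Conditional certificate: both cruxes of route `RenyiTelescope` are
OPEN; rung R3 and the mass gap are NOT proved. [cite: Balaban1985UV3, (7) p.257 and (70)-(71) p.273; King1986, Thm 3.4 p.334] -/
theorem largeFieldMassRefinementTail_of_renyiTelescopeR
    (hC : Summit.QuantumFields.YangMills.Theses.RenyiTelescope.CutoffRenyiLR)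
    (hF : Summit.QuantumFields.YangMills.Theses.RenyiTelescope.FineRegimeUnitTailL) :
    Summit.QuantumFields.YangMills.Theses.SmallFieldWidening.LargeFieldMassRefinementTail :=
  largeFieldMassRefinementTail_of_unitTopSummable (unitTopSummable_of_renyiTelescopeR hC hF)

/-- **THE STAFFING FACT after the repair**: the two OPEN cruxes `CutoffRenyiLR` (stmt-QuantumFields-27544) and `FineRegimeUnitTailL`
(stmt-QuantumFields-27138) close crux K2-L `HistoryTailL` of route `UnitScaleTilt` (stmt-QuantumFields-19936, via the re-glue
`historyTailOfRenyiTelescopeR`, item stmt-QuantumFields-27545) AND crux r3 of route `SmallFieldWidening` (stmt-QuantumFields-22884) at once.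
Conditional; nothing about the mass gap. [cite: Balaban1985UV3, (7) p.257 and (70)-(71) p.273; King1986, Thm 3.4 p.334] -/
theorem historyTailL_and_largeFieldMassRefinementTail_of_renyiTelescopeR
    (hC : Summit.QuantumFields.YangMills.Theses.RenyiTelescope.CutoffRenyiLR)
    (hF : Summit.QuantumFields.YangMills.Theses.RenyiTelescope.FineRegimeUnitTailL) :
    Summit.QuantumFields.YangMills.Theses.UnitScaleTilt.HistoryTailL ∧
      Summit.QuantumFields.YangMills.Theses.SmallFieldWidening.LargeFieldMassRefinementTail :=
  ⟨historyTailOfRenyiTelescopeR hC hF, largeFieldMassRefinementTail_of_renyiTelescopeR hC hF⟩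

end Summit.QuantumFields.YangMills.Theorems.LargeFieldMassRefinementTailOfRenyiTelescopeR

end
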